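import Summits.KontsevichZagierPeriods.KontsevichZagierPeriods.Theorems.RootDecompRelativeModAbsoluteRegFoldingDegOneP05

/-!
# `RegFoldingDegOne` (route `RootDecompRelativeModAbsolute`, support item stmt-KontsevichZagierPeriods-30571) — PROVED · part 6/14

Cell `decomp-kz`, lens 3 (decomp-kz-lens-3 g9): `regFoldingDegOne_holds :
Theses.RootDecompRelativeModAbsolute.RegFoldingDegOne` BY NAME (in part 14/14) — every Kontsevich–Zagier
integral representation on `ℝ²` whose integrand is a quotient `p/q` of `ℚ`-polynomials with `deg_t q ≤ 1`,
`q ≠ 0` on the domain, is equivalent in `KZ.relations` to `[g] + Σᵢ [Uᵢ]`, the `Uᵢ` honest 2-cells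
`[g.domain × (0,1), hᵢ(x) θ^{Mᵢ}/(1 + θ^{eᵢ} κᵢ(x))]` (unfolded REGULARISED log/arctan monomials), with the
fibre integrals matching a.e.  Architecture: §1–§2 regularised terms `RTerm`, `RegFolding d`; §7 a.e.-congruence;
§8 gluing (`FoldsTo`); §9 one-band toolkit; §P analytic core (kernel independence); §10 cylinders; §11 affine band
chart; §13 `RegFolding 1` from a CAD band cover a.e. + vanishing on unbounded bands; last part: the edge to the born
item text and `regFoldingDegOne_holds`.

Source: `HOME/decomp-kz-lens-3/g9/landing/RootDecompRelativeModAbsoluteRegFoldingDegOne.lean` sha256 60038aa44a5f6303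
(4275 l; critic decomp-kz-crit-1 g2 CLEARED/kernel-confirmed 2026-08-30T09:41:19Z, std axioms), split mechanically
into 14 modules ≤ 400 lines by the landing seat decomp-kz-census-1 g7 (contexts re-opened per part; generic docstrings
added where the source had none; parts 1–13 do not import the route file).  No `sorry`; standard axioms.
References: [cite: KontsevichZagier2001, §1.2]; Basu–Pollack–Roy 2006 Def. 5.1 / Cor. 5.7; Bochnak–Coste–Roy 1998 §2.9.
-/

noncomputable section

open Set MeasureTheory Filter Topology
open scoped BigOperators
open Literature.NumberTheory.Transcendental Literature.ModelTheory.ExponentialFields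

namespace Summit.KontsevichZagierPeriods.RootDecompRelativeModAbsolute.Rung30571

-- PRIVATE copy (landed twin in farm-unbuilt HyperbolicBloch module; dedup.landed): isSemialgebraicFunOn_finset_sum
/-- Finite sums of `ℚ`-semialgebraic functions are `ℚ`-semialgebraic. [BCR 1998, Prop. 2.2.6] -/
private theorem isSemialgebraicFunOn_finset_sum {n : ℕ} {s : Set (Fin n → ℝ)} (hs : IsSemialgebraic ℚ s)
    {ι : Type*} (I : Finset ι) {f : ι → (Fin n → ℝ) → ℝ}
    (hf : ∀ i ∈ I, IsSemialgebraicFunOn ℚ s (f i)) :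
    IsSemialgebraicFunOn ℚ s (fun x => ∑ i ∈ I, f i x) := by
  classical
  induction I using Finset.induction_on with
  | empty => exact (isSemialgebraicFunOn_ratCast hs 0).congr fun x _ => by simp
  | insert a I ha ih =>
    have h1 : IsSemialgebraicFunOn ℚ s (f a) := hf a (Finset.mem_insert_self a I)
    have h2 := ih fun i hi => hf i (Finset.mem_insert_of_mem hi)
    refine (IsSemialgebraicFunOn.add_holds h1 h2).congr fun x _ => ?_
    simp only [Pi.add_apply, Finset.sum_insert ha]

namespace RegularisedLogLayer

section Folds

variable {b : ℕ}

/-- **Base-to-cylinder integrability for polynomial-in-θ integrands**: `Σ aₖ(x)θ^k ∈ L¹(cyl G)` as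
soon as every `aₖ ∈ L¹(G)` (Tonelli; `|Σ aₖθ^k| ≤ Σ|aₖ|` on `[0,1]`). -/
theorem integrableOn_cyl_polynomial {G : Set (Fin b → ℝ)} (hG : IsSemialgebraic ℚ G) {m : ℕ}
    {a : Fin (m + 1) → (Fin b → ℝ) → ℝ} (ha : ∀ k, IsSemialgebraicFunOn ℚ G (a k))
    (hai : ∀ k, IntegrableOn (a k) G) :
    IntegrableOn (fun z : Fin (b + 1) → ℝ =>
      ∑ k : Fin (m + 1), a k (Fin.init z) * z (Fin.last b) ^ (k : ℕ)) (RTerm.cyl G) := by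
  have h0 : IsSemialgebraicFunOn ℚ G (fun _ => (0 : ℝ)) :=
    (isSemialgebraicFunOn_ratCast hG 0).congr fun x _ => by simp
  have h1 : IsSemialgebraicFunOn ℚ G (fun _ => (1 : ℝ)) :=
    (isSemialgebraicFunOn_ratCast hG 1).congr fun x _ => by simp
  have hB : IsSemialgebraic ℚ (KZlog.band G (fun _ => (0 : ℝ)) fun _ => (1 : ℝ)) :=
    KZlog.isSemialgebraic_band h0 h1
  have hBm : MeasurableSet (KZlog.band G (fun _ => (0 : ℝ)) fun _ => (1 : ℝ)) :=
    hB.measurableSet_holds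
  have hBG : KZlog.band G (fun _ => (0 : ℝ)) (fun _ => (1 : ℝ)) ⊆ {z | Fin.init z ∈ G} :=
    fun z hz => hz.1
  set W : (Fin (b + 1) → ℝ) → ℝ := fun z =>
    ∑ k : Fin (m + 1), a k (Fin.init z) * z (Fin.last b) ^ (k : ℕ) with hW
  have hWsa : IsSemialgebraicFunOn ℚ (KZlog.band G (fun _ => (0 : ℝ)) fun _ => (1 : ℝ)) W := by
    refine isSemialgebraicFunOn_finset_sum hB _ fun k _ => ?_
    exact (IsSemialgebraicFunOn.mul_holds ((ha k).comp_init_mono hB hBG)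
      (isSemialgebraicFunOn_pow hB (isSemialgebraicFunOn_apply hB (Fin.last b)) (k : ℕ))).congr
      fun z _ => rfl
  have hK : IntegrableOn (fun x => ∑ k : Fin (m + 1), |a k x|) G :=
    integrable_finsetSum _ fun k _ => (hai k).abs
  have hWi : IntegrableOn W (KZlog.band G (fun _ => (0 : ℝ)) fun _ => (1 : ℝ)) := by
    refine KZlog.integrableOn_band_of_lintegral_fibre_le hG.measurableSet_holds hBm
      (fun x t => KZlog.snoc_mem_band) (KZ.aestronglyMeasurable_of_isSemialgebraicFunOn hWsa hBm)
      (fun x _ => ?_) hK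
    have hb : ∀ t ∈ Icc (0 : ℝ) 1,
        ‖W (Fin.snoc x t)‖ₑ ≤ ‖∑ k : Fin (m + 1), |a k x|‖ₑ := by
      intro t ht
      simp only [hW, Fin.init_snoc, Fin.snoc_last]
      rw [Real.enorm_eq_ofReal_abs, Real.enorm_eq_ofReal_abs]
      refine ENNReal.ofReal_le_ofReal ((Finset.abs_sum_le_sum_abs _ _).trans
        ((Finset.sum_le_sum fun k _ => ?_).trans (le_abs_self _)))
      rw [abs_mul, abs_pow]
      exact mul_le_of_le_one_right (abs_nonneg _)
        (pow_le_one₀ (abs_nonneg t) (abs_le.2 ⟨by linarith [ht.1], ht.2⟩))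
    calc ∫⁻ t in Icc (0 : ℝ) 1, ‖W (Fin.snoc x t)‖ₑ
        ≤ ∫⁻ _ in Icc (0 : ℝ) 1, ‖∑ k : Fin (m + 1), |a k x|‖ₑ := setLIntegral_mono measurable_const hb
      _ = ‖∑ k : Fin (m + 1), |a k x|‖ₑ := by
        rw [setLIntegral_const, Real.volume_Icc, sub_zero, ENNReal.ofReal_one, mul_one]
  exact hWi.mono_set fun z hz => ⟨hz.1, hz.2.1.le, hz.2.2.le⟩

/-- **The regularised split of one pole term, folded** (recipe step 5b): on a cylinder, an integrand
`Σ_{k≤m} aₖ(x)θ^k + h(x)·θ^M/(1+θ^e κ(x))` with ℚ-semialgebraic coefficients, `aₖ ∈ L¹(G)` (this is what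
`integrable_coeffs_away` / `integrable_coeffs_taylor'` of `PlanRegFoldingDegOne.lean` deliver) and
`κ > −1` folds to the two-summand term `[G, Σ aₖ/(k+1)] + [G, h·ℓ_{M,e}(κ)]`; the integrability of the
pole summand is READ OFF from that of `r` and of the polynomial part (difference), its semialgebraicity
likewise — no division lemma needed. -/
theorem foldsTo_cyl_poly_add_single (r : KZ.IntegralRep (b + 1)) {G : Set (Fin b → ℝ)}
    (hG : IsSemialgebraic ℚ G) {m : ℕ} {a : Fin (m + 1) → (Fin b → ℝ) → ℝ}
    (ha : ∀ k, IsSemialgebraicFunOn ℚ G (a k)) (hai : ∀ k, IntegrableOn (a k) G)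
    {h κ : (Fin b → ℝ) → ℝ} (hh : IsSemialgebraicFunOn ℚ G h) (hκ : IsSemialgebraicFunOn ℚ G κ)
    {M e : ℕ} (he : e = 1 ∨ e = 2) (hκ1 : ∀ x ∈ G, -1 < κ x) (hdom : r.domain = RTerm.cyl G)
    (hint : EqOn r.integrand (fun z =>
      (∑ k : Fin (m + 1), a k (Fin.init z) * z (Fin.last b) ^ (k : ℕ)) +
        h (Fin.init z) * kernel M e (κ (Fin.init z)) (z (Fin.last b))) r.domain) :
    ∃ hT : ((RTerm.base G (fun x => ∑ k : Fin (m + 1), a k x / ((k : ℕ) + 1))).glue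
        (RTerm.single G h κ M e)).Admissible,
      FoldsTo r ((RTerm.base G (fun x => ∑ k : Fin (m + 1), a k x / ((k : ℕ) + 1))).glue
        (RTerm.single G h κ M e)) hT := by
  have hcyl : IsSemialgebraic ℚ (RTerm.cyl G) := RTerm.isSemialgebraic_cyl hG
  set P : (Fin (b + 1) → ℝ) → ℝ := fun z =>
    ∑ k : Fin (m + 1), a k (Fin.init z) * z (Fin.last b) ^ (k : ℕ) with hP
  set Q : (Fin (b + 1) → ℝ) → ℝ := fun z =>
    h (Fin.init z) * kernel M e (κ (Fin.init z)) (z (Fin.last b)) with hQ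
  have hPi : IntegrableOn P (RTerm.cyl G) := integrableOn_cyl_polynomial hG ha hai
  have hPsa : IsSemialgebraicFunOn ℚ (RTerm.cyl G) P := by
    refine isSemialgebraicFunOn_finset_sum hcyl _ fun k _ => ?_
    exact (IsSemialgebraicFunOn.mul_holds ((ha k).comp_init_mono hcyl fun z hz => hz.1)
      (isSemialgebraicFunOn_pow hcyl (isSemialgebraicFunOn_apply hcyl (Fin.last b)) (k : ℕ))).congr
      fun z _ => rfl
  have hsum : EqOn r.integrand (P + Q) (RTerm.cyl G) := fun z hz => by
    rw [hint (hdom ▸ hz)]; rfl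
  have hri : IntegrableOn r.integrand (RTerm.cyl G) := hdom ▸ r.integrableOn
  have hQi : IntegrableOn Q (RTerm.cyl G) :=
    ((hri.congr_fun hsum hcyl.measurableSet_holds).sub hPi).congr_fun
      (fun z _ => by simp) hcyl.measurableSet_holds
  have hQsa : IsSemialgebraicFunOn ℚ (RTerm.cyl G) Q :=
    (IsSemialgebraicFunOn.sub_holds ((hdom ▸ r.isSemialgebraicFunOn_integrand).congr hsum)
      hPsa).congr fun z _ => by simp
  let r₁ : KZ.IntegralRep (b + 1) := ⟨RTerm.cyl G, P, hcyl, hPsa, hPi⟩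
  let r₂ : KZ.IntegralRep (b + 1) := ⟨RTerm.cyl G, Q, hcyl, hQsa, hQi⟩
  obtain ⟨hT₁, h₁⟩ := foldsTo_cyl_polynomial r₁ hG ha rfl fun z _ => rfl
  obtain ⟨hT₂, h₂⟩ := foldsTo_cyl_monomial r₂ hG hh hκ (M := M) he hκ1 rfl fun z _ => rfl
  exact ⟨_, FoldsTo.add (r₁ := r₁) (r₂ := r₂) hdom.symm hdom.symm (hdom ▸ hsum) h₁ h₂⟩

/-- **A.e. congruence of integrands preserves folds** (same domain). -/
theorem FoldsTo.of_ae_eq {r r' : KZ.IntegralRep (b + 1)} {T : RTerm b} {hT : T.Admissible}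
    (hd : r.domain = r'.domain) (hae : ∀ᵐ z, z ∈ r.domain → r.integrand z = r'.integrand z)
    (h : FoldsTo r' T hT) : FoldsTo r T hT := by
  refine FoldsTo.of_rel_of_fibre_ae ?_ ?_ h
  · refine AECongr.of_sub_of_mem_relations_of_indicator_ae r r' ?_
    filter_upwards [hae] with z hz
    by_cases hzd : z ∈ r.domain
    · rw [indicator_of_mem hzd, indicator_of_mem (hd ▸ hzd), hz hzd]
    · rw [indicator_of_notMem hzd, indicator_of_notMem (hd ▸ hzd)]
  · have h2 := ae_ae_snoc hae
    filter_upwards [h2] with x hx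
    rw [← hd]
    refine setIntegral_congr_ae ((KZ.IntegralRep.measurableSet_domain_holds r).preimage
      (measurable_snoc x)) ?_
    filter_upwards [hx] with t ht hmem using ht hmem

/-- **No pole ON a section** (recipe steps 3/5a): if `R(x)/θ` is integrable on the cylinder over `G`
then `R = 0` a.e. on `G` (`1/θ ∉ L¹(0,1)`, fibrewise via Fubini). -/
theorem ae_eq_zero_of_integrableOn_cyl_div {G : Set (Fin b → ℝ)} (hG : IsSemialgebraic ℚ G)
    {R : (Fin b → ℝ) → ℝ}
    (hRi : IntegrableOn (fun z : Fin (b + 1) → ℝ => R (Fin.init z) / z (Fin.last b)) (RTerm.cyl G)) :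
    ∀ᵐ x : (Fin b → ℝ), x ∈ G → R x = 0 := by
  have hcm : MeasurableSet (RTerm.cyl G) := (RTerm.isSemialgebraic_cyl hG).measurableSet_holds
  have hI : Integrable ((RTerm.cyl G).indicator fun z : Fin (b + 1) → ℝ =>
      R (Fin.init z) / z (Fin.last b)) := (integrable_indicator_iff hcm).2 hRi
  filter_upwards [ae_integrable_snoc hI] with x hx hxG
  by_contra hR
  have hind : (fun t : ℝ => (RTerm.cyl G).indicator (fun z : Fin (b + 1) → ℝ =>
      R (Fin.init z) / z (Fin.last b)) (Fin.snoc x t)) =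
      (Ioo (0 : ℝ) 1).indicator fun t => R x / t := by
    funext t
    by_cases ht : t ∈ Ioo (0 : ℝ) 1
    · have hmem : (Fin.snoc x t : Fin (b + 1) → ℝ) ∈ RTerm.cyl G := ⟨by simpa using hxG, by simpa using ht⟩
      rw [indicator_of_mem hmem, indicator_of_mem ht]
      simp
    · have hmem : (Fin.snoc x t : Fin (b + 1) → ℝ) ∉ RTerm.cyl G := fun hz => ht (by simpa using hz.2)
      rw [indicator_of_notMem hmem, indicator_of_notMem ht]
  rw [hind, integrable_indicator_iff measurableSet_Ioo] at hx
  have hinv : IntegrableOn (fun t : ℝ => t⁻¹) (Ioo (0 : ℝ) 1) := by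
    refine IntegrableOn.congr_fun (hx.const_mul (R x)⁻¹) (fun t _ => ?_) measurableSet_Ioo
    show (R x)⁻¹ * (R x / t) = t⁻¹
    rw [div_eq_mul_inv, ← mul_assoc, inv_mul_cancel₀ hR, one_mul]
  have := (intervalIntegrable_inv_iff (a := (0 : ℝ)) (b := 1)).1
    ((intervalIntegrable_iff_integrableOn_Ioo_of_le zero_le_one).2 hinv)
  rcases this with h01 | hmem
  · exact zero_ne_one h01
  · exact hmem (by simp)

end Folds

/-! ## §P  The analytic core of g8 (`PlanRegFoldingDegOne.lean`, VERBATIM; namespace `RegularisedLogLayer.Plan`) -/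

namespace Plan

/-- `ℓ₀(κ) = ∫₀¹ dθ/(1+κθ)` (`= log(1+κ)/κ` for `κ ≠ 0`, `= 1` at `κ = 0`). -/
def ell0 (κ : ℝ) : ℝ := ∫ θ in Ioo (0 : ℝ) 1, 1 / (1 + κ * θ)

/-- **Kernel independence away from `κ = 0`** (cases A, C, D of NODE-g8 §3; order `M = 0`). -/
def KernelIndependenceAway (m : ℕ) (η : ℝ) : Prop :=
  ∃ c : ℝ, 0 < c ∧ ∀ κ : ℝ, -1 < κ → η ≤ |κ| →
    ∀ (a : Fin (m + 1) → ℝ) (b : ℝ),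
      c * (∑ k, |a k| + |b| * ell0 κ) ≤
        ∫ θ in Ioo (0 : ℝ) 1, |∑ k : Fin (m + 1), a k * θ ^ (k : ℕ) + b / (1 + κ * θ)|

/-- **Kernel independence near `κ = 0` after Taylor regularisation to order `m + 1`** (case B). -/
def KernelIndependenceTaylor (m : ℕ) : Prop :=
  ∃ η₁ : ℝ, 0 < η₁ ∧ ∃ c : ℝ, 0 < c ∧ ∀ κ : ℝ, |κ| ≤ η₁ →
    ∀ (a : Fin (m + 1) → ℝ) (b : ℝ),
      c * (∑ k, |a k| + |b|) ≤
        ∫ θ in Ioo (0 : ℝ) 1,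
          |∑ k : Fin (m + 1), a k * θ ^ (k : ℕ) + b * θ ^ (m + 1) / (1 + κ * θ)|

/-- The two lemmas the prover needs, for every polynomial degree `m` and every `η > 0`. -/
def EndpointAnalysis : Prop :=
  (∀ (m : ℕ) (η : ℝ), 0 < η → KernelIndependenceAway m η) ∧ ∀ m : ℕ, KernelIndependenceTaylor m

/-- Sanity (`m = 0`, `b = 0`): the inequality is an equality with `c = 1` for constants — the
statements are not vacuous in the trivial direction. -/
theorem kernelIndependence_const (a : ℝ) :
    (1 : ℝ) * (|a| + |(0 : ℝ)|) ≤ ∫ θ in Ioo (0 : ℝ) 1, |a + 0 * θ ^ 1 / (1 + 0 * θ)| := by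
  simp

/-! ## The Taylor lemma PROVED (case B, every degree `m`)

`KernelIndependenceTaylor m` follows from the `ℓ¹–L¹` comparison for polynomials of degree `≤ m+1` on
`(0,1)` (compactness of the `ℓ¹`-sphere + a non-zero polynomial is not a.e. zero) by writing
`b θ^{m+1}/(1+κθ) = b θ^{m+1} − b κ θ^{m+2}/(1+κθ)` and absorbing the remainder (`≤ 2|κ||b|`). -/

section Taylor

variable {d : ℕ}

/-- The polynomial function with coefficient vector `a`. -/
def polyFun (a : Fin (d + 1) → ℝ) (θ : ℝ) : ℝ := ∑ k : Fin (d + 1), a k * θ ^ (k : ℕ)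

/-- `continuous_polyFun`: auxiliary theorem of the `RegFoldingDegOne` (stmt-30571) development — see the module docstring; statement and proof verbatim from the lens-3 g9 landing file. -/
theorem continuous_polyFun (a : Fin (d + 1) → ℝ) : Continuous (polyFun a) := by
  unfold polyFun
  exact continuous_finsetSum _ fun k _ => by fun_prop

/-- `continuous_polyFun_coeff`: auxiliary theorem of the `RegFoldingDegOne` (stmt-30571) development — see the module docstring; statement and proof verbatim from the lens-3 g9 landing file. -/
theorem continuous_polyFun_coeff (θ : ℝ) : Continuous fun a : Fin (d + 1) → ℝ => polyFun a θ := by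
  unfold polyFun
  exact continuous_finsetSum _ fun k _ => by fun_prop

/-- `abs_polyFun_le`: auxiliary theorem of the `RegFoldingDegOne` (stmt-30571) development — see the module docstring; statement and proof verbatim from the lens-3 g9 landing file. -/
theorem abs_polyFun_le (a : Fin (d + 1) → ℝ) {θ : ℝ} (hθ : θ ∈ Icc (0 : ℝ) 1) :
    |polyFun a θ| ≤ ∑ k, |a k| := by
  unfold polyFun
  refine (Finset.abs_sum_le_sum_abs _ _).trans (Finset.sum_le_sum fun k _ => ?_)
  rw [abs_mul, abs_pow, abs_of_nonneg hθ.1]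
  calc |a k| * θ ^ (k : ℕ) ≤ |a k| * 1 := by
        gcongr
        exact pow_le_one₀ hθ.1 hθ.2
    _ = |a k| := mul_one _

/-- `polyFun_smul`: auxiliary theorem of the `RegFoldingDegOne` (stmt-30571) development — see the module docstring; statement and proof verbatim from the lens-3 g9 landing file. -/
theorem polyFun_smul (a : Fin (d + 1) → ℝ) (s θ : ℝ) :
    polyFun (fun k => a k / s) θ = polyFun a θ / s := by
  unfold polyFun
  rw [Finset.sum_div]
  refine Finset.sum_congr rfl fun k _ => ?_
  ring

/-- The `L¹(u,v)`-norm of the polynomial with coefficients `a`. -/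
def N (u v : ℝ) (a : Fin (d + 1) → ℝ) : ℝ := ∫ θ in Ioo u v, |polyFun a θ|

/-- `integrableOn_abs_polyFun`: auxiliary theorem of the `RegFoldingDegOne` (stmt-30571) development — see the module docstring; statement and proof verbatim from the lens-3 g9 landing file. -/
theorem integrableOn_abs_polyFun (u v : ℝ) (a : Fin (d + 1) → ℝ) :
    IntegrableOn (fun θ => |polyFun a θ|) (Ioo u v) :=
  ((continuous_polyFun a).abs.continuousOn.integrableOn_Icc).mono_set Ioo_subset_Icc_self

/-- `N_nonneg`: auxiliary theorem of the `RegFoldingDegOne` (stmt-30571) development — see the module docstring; statement and proof verbatim from the lens-3 g9 landing file. -/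
theorem N_nonneg (u v : ℝ) (a : Fin (d + 1) → ℝ) : 0 ≤ N u v a :=
  setIntegral_nonneg measurableSet_Ioo fun _ _ => abs_nonneg _

/-- `N_smul`: auxiliary theorem of the `RegFoldingDegOne` (stmt-30571) development — see the module docstring; statement and proof verbatim from the lens-3 g9 landing file. -/
theorem N_smul (u v : ℝ) (a : Fin (d + 1) → ℝ) {s : ℝ} (hs : 0 < s) :
    N u v (fun k => a k / s) = N u v a / s := by
  unfold N
  simp_rw [polyFun_smul, abs_div, abs_of_pos hs]
  exact MeasureTheory.integral_div _ _

/-- `N u v` is continuous for `[u,v] ⊆ [0,1]` (dominated convergence with a locally uniform bound). -/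
theorem continuous_N {u v : ℝ} (hu : 0 ≤ u) (hv : v ≤ 1) : Continuous (N (d := d) u v) := by
  refine continuous_iff_continuousAt.2 fun a₀ => ?_
  unfold N
  set B : ℝ := ∑ k : Fin (d + 1), (|a₀ k| + 1) with hB
  refine MeasureTheory.continuousAt_of_dominated (bound := fun _ => B) ?_ ?_ ?_ ?_
  · exact Eventually.of_forall fun a =>
      (continuous_polyFun a).abs.aestronglyMeasurable
  · have hball : ∀ᶠ a in 𝓝 a₀, dist a a₀ < 1 := Metric.ball_mem_nhds a₀ one_pos
    filter_upwards [hball] with a ha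
    refine (ae_restrict_mem measurableSet_Ioo).mono fun θ hθ => ?_
    rw [Real.norm_eq_abs, abs_abs]
    have hθ01 : θ ∈ Icc (0 : ℝ) 1 := ⟨hu.trans hθ.1.le, hθ.2.le.trans hv⟩
    refine (abs_polyFun_le a hθ01).trans (Finset.sum_le_sum fun k _ => ?_)
    have hk : dist (a k) (a₀ k) ≤ dist a a₀ := dist_le_pi_dist a a₀ k
    rw [Real.dist_eq] at hk
    have := abs_sub_abs_le_abs_sub (a k) (a₀ k)
    linarith
  · exact (continuousOn_const.integrableOn_Icc (a := u) (b := v)).mono_set Ioo_subset_Icc_self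
  · exact Eventually.of_forall fun θ => (continuous_polyFun_coeff θ).abs.continuousAt

/-- The `Polynomial` with coefficient vector `a`. -/
def polyOf (a : Fin (d + 1) → ℝ) : Polynomial ℝ :=
  ∑ k : Fin (d + 1), Polynomial.C (a k) * Polynomial.X ^ (k : ℕ)

/-- `eval_polyOf`: auxiliary theorem of the `RegFoldingDegOne` (stmt-30571) development — see the module docstring; statement and proof verbatim from the lens-3 g9 landing file. -/
theorem eval_polyOf (a : Fin (d + 1) → ℝ) (θ : ℝ) : (polyOf a).eval θ = polyFun a θ := by
  simp [polyOf, polyFun, Polynomial.eval_finsetSum]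

/-- `coeff_polyOf`: auxiliary theorem of the `RegFoldingDegOne` (stmt-30571) development — see the module docstring; statement and proof verbatim from the lens-3 g9 landing file. -/
theorem coeff_polyOf (a : Fin (d + 1) → ℝ) (j : Fin (d + 1)) : (polyOf a).coeff (j : ℕ) = a j := by
  rw [polyOf, Polynomial.finsetSum_coeff]
  simp_rw [Polynomial.coeff_C_mul_X_pow]
  rw [Finset.sum_eq_single j]
  · simp
  · intro k _ hkj
    rw [if_neg]
    exact fun hh => hkj (Fin.ext hh.symm)
  · simp

/-- `eq_zero_of_polyOf_eq_zero`: auxiliary theorem of the `RegFoldingDegOne` (stmt-30571) development — see the module docstring; statement and proof verbatim from the lens-3 g9 landing file. -/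
theorem eq_zero_of_polyOf_eq_zero (a : Fin (d + 1) → ℝ) (h : polyOf a = 0) : a = 0 := by
  funext j
  rw [← coeff_polyOf a j, h, Polynomial.coeff_zero, Pi.zero_apply]

/-- A polynomial vanishing on a non-trivial interval `(u,v)` has zero coefficients. -/
theorem eq_zero_of_polyFun_eq_zero {u v : ℝ} (huv : u < v) (a : Fin (d + 1) → ℝ)
    (h : ∀ θ ∈ Ioo u v, polyFun a θ = 0) : a = 0 := by
  have hroots : Set.Infinite {θ : ℝ | (polyOf a).IsRoot θ} :=
    (Ioo_infinite huv).mono fun θ hθ => by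
      simp only [mem_setOf_eq, Polynomial.IsRoot, eval_polyOf, h θ hθ]
  exact eq_zero_of_polyOf_eq_zero a (Polynomial.eq_zero_of_infinite_isRoot _ hroots)

/-- `N_pos_of_ne_zero`: auxiliary theorem of the `RegFoldingDegOne` (stmt-30571) development — see the module docstring; statement and proof verbatim from the lens-3 g9 landing file. -/
theorem N_pos_of_ne_zero {u v : ℝ} (huv : u < v) {a : Fin (d + 1) → ℝ} (ha : a ≠ 0) :
    0 < N u v a := by
  refine (N_nonneg u v a).lt_of_ne fun h0 => ha ?_
  have hae : (fun θ => |polyFun a θ|) =ᵐ[volume.restrict (Ioo u v)] 0 := by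
    refine (integral_eq_zero_iff_of_nonneg_ae ?_ (integrableOn_abs_polyFun u v a)).1 h0.symm
    exact Eventually.of_forall fun θ => abs_nonneg _
  have hEq : EqOn (fun θ => |polyFun a θ|) 0 (Ioo u v) :=
    Measure.eqOn_open_of_ae_eq hae isOpen_Ioo (continuous_polyFun a).abs.continuousOn
      continuousOn_const
  exact eq_zero_of_polyFun_eq_zero huv a fun θ hθ => abs_eq_zero.1 (hEq hθ)

end Taylor

end Plan

end RegularisedLogLayer

end Summit.KontsevichZagierPeriods.RootDecompRelativeModAbsolute.Rung30571

end
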